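/-
Copyright (c) 2026 the pub-hodgecm-mathlib formalisation cell (harness21).  Prover seat hodgecm-mathlib-K2E3-p12 (g9), programme R90-TF,
section S4 = Rogawski Ch. 13.1–2 (base `R90-C131`), deal S4#C-TP (S4 dealer K2E2-plan (g6), 2026-09-04T16:36Z); h413 = `stmt-HodgeConjecture-24833`.
-/
import Summits.HodgeConjecture.HodgeConjecture.Theorems.R90S4TwistedTransferDefs   -- ★ p861881 C-TT: `stableEpsOrbitalIntegral`, `IsEpsTransferPair`, `isEpsTransferPair_zero` (brings ★ `Ch4Sec10`, ★ `LocalTransfer`)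
import Literature.NumberTheory.Automorphic.LocalStableOrbitalFinite            -- ★ `stableOrbitalIntegralRel_smul_fun` (homogeneity of `Φ^st`), ★ `stableOrbitalIntegralRel_add` (additivity from class additivity + finite non-zero support)
import HarnessLib

/-!
# R90-TF · S4 (Ch. 13.1–2) · S4#C-TP — the twisted transfer relation «`φ → f`» (4.10.2) is LINEAR: closed under `c • ·` (unconditionally)
# and under `+` ∕ `−` (under explicit per-class integrability and class-finiteness binders)

Cell `hodgecm-mathlib`, crux H413 (`stmt-HodgeConjecture-24833`), route of record `HCCMUnconditional`; programme R90-TF, section S4 = Rogawski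
Ch. 13.1–2 (base `R90-C131`), seat K2E3-p12 (g9), deal S4#C-TP of the S4 dealer K2E2-plan (g6).  Lane `--supports stmt-HodgeConjecture-24833 --as
helper`; THEOREMS ONLY (no definition, no instance, no notation, no `sorry`); imports ★ C-TT `R90S4TwistedTransferDefs` + ★ `LocalStableOrbitalFinite` (+ HarnessLib).
CONSUMER: Lines C ED. 1 (`Cruxes/H413/Lines/R90_S4_LocalBaseChangeC.lean`) — linearity of the lift identity built on ★ `IsEpsTransferPair`.

THE (ELEMENTARY) MATHEMATICS [Rogawski1990, §4.10 (4.10.1)–(4.10.2) pp. 57–58; §4.1 (4.1.1) p. 39].  Both sides of (4.10.2),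
`Φ^st_ε(δ, φ) = Σᶠ_c Φ_ε(δ_c, φ)` (★ `stableEpsOrbitalIntegral` = ★ `Ch4Sec10.epsKappaOrbitalIntegral` at `κ = 1`, `e = 1`) and
`Φ^st(γ, f) = Σᶠ_{[γ′]} Φ([γ′], f)` (★ `stableOrbitalIntegralRel`), are `finsum`s of Bochner integrals of the translates `y ↦ φ(y δ_c ε(y)⁻¹)`
(★ `descEpsConj`) resp. `y ↦ f(y γ′ y⁻¹)` (★ `descConj`).  HOMOGENEITY `Φ(c • φ) = c · Φ(φ)` holds UNCONDITIONALLY: the Bochner integral is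
homogeneous without integrability (★ `integral_smul`) and `c * Σᶠ = Σᶠ c * ·` holds in `ℂ` without finiteness (Mathlib `mul_finsum_mem`, no zero
divisors; on the `G`-side this is ★ `stableOrbitalIntegralRel_smul_fun`).  ADDITIVITY `Φ(φ + ψ) = Φ(φ) + Φ(ψ)` needs (i) integrability of BOTH integrands on every contributing class
(Bochner junk: `∫ (F + G) = 0 ≠ ∫ F + ∫ G` when `F + G` is integrable but `F` is not) and (ii) finiteness of the set of contributing classes
(`𝒟_ε(δ∕F)` resp. `𝔇(G_γ∕F)`; a `finsum` over an infinite support is `0`, so `Σᶠ (a + b) = Σᶠ a + Σᶠ b` fails without it) — both are carried as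
EXPLICIT BINDERS, never hidden (the tree claims neither today).  Hence: `IsEpsTransferPair φ f → IsEpsTransferPair (c • φ) (c • f)` and
`… (-φ) (-f)` unconditionally; `IsEpsTransferPair φ f → IsEpsTransferPair ψ g → IsEpsTransferPair (φ + ψ) (f + g)` (and `(φ - ψ) (f - g)`) under
(i)+(ii) on the ε-side at every ε-regular `δ` and on the `G`-side at every norm `γ ∈ 𝒩(δ)` of an ε-regular `δ` — exactly the pairs (4.10.2) quantifies
over.  ★ `isEpsTransferPair_zero` (`0 → 0`) is C-TT's.
* §1 `G`-side, generic group `G` (over ★ `orbitalIntegral_add` ∕ `_sub`; homogeneity IS ★ `stableOrbitalIntegralRel_smul_fun` and additivity from class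
  additivity IS ★ `stableOrbitalIntegralRel_add` — both in ★ `LocalStableOrbitalFinite`, cited not restated): `classOrbitalIntegral_add` ∕ `_sub`,
  `stableOrbitalIntegralRel_neg` ∕ `_add_of_integrable` ∕ `_sub_of_integrable`.
* §2 ε-side, generic `(G̃, ε)` (★ `Ch4Sec10`): `epsOrbitalIntegral_smul` ∕ `_add` ∕ `_neg` ∕ `_sub`, `classEpsOrbitalIntegral_smul` ∕ `_add` ∕ `_sub`,
  `epsKappaOrbitalIntegral_smul` ∕ `_neg` ∕ `_add` ∕ `_sub` (any `stε`, `κ`, `e`, `Z′`).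
* §3 S4 instance (`G̃_v = GtLoc L v`, `ε_v = epsLoc L Φ v`, `G_v = U(Φ)(L⁺_v)`): `stableEpsOrbitalIntegral_smul` ∕ `_neg` ∕ `_add` ∕ `_sub`;
  **`IsEpsTransferPair.smul`**, **`.neg`**, **`.add`**, **`.sub`**.

HONEST LABEL: support lemmas — no socket moves by this file; HC_CM is proved only modulo the 7 printed citations (2 remaining named inputs: hLiu418 =
`stmt-HodgeConjecture-24832`, h413 = `stmt-HodgeConjecture-24833`) until rung 0 closes.  REL ≠ ★ ≠ BUILT.

## References
* [Rogawski1990] J. D. Rogawski, *Automorphic Representations of Unitary Groups in Three Variables*, Ann. of Math. Stud. 123 (1990): §1.6 pp. 5–6,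
  §4.1 (4.1.1) pp. 39–40, §4.10 (4.10.1)–(4.10.2) and Prop. 4.10.1 (a) pp. 57–58.
-/

set_option autoImplicit false
set_option linter.dupNamespace false

noncomputable section

open MeasureTheory
open scoped NumberField MatrixGroups
open Literature.NumberTheory.Rogawski1990 Literature.NumberTheory.Rogawski1990.Ch4Sec10
open Literature.NumberTheory.Automorphic Literature.MeasureTheory.Group
open IsDedekindDomain NumberField

namespace Summit.HodgeConjecture.HodgeConjecture.R90.S4

/-! ## §1 The `G`-side: `Φ([γ], ·)` and `Φ^st(γ, ·)` are linear (generic group) -/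

section GSide

variable {G : Type*} [Group G] [∀ γ : G, MeasurableSpace (G ⧸ Subgroup.centralizer ({γ} : Set G))]

/-- `Φ([γ], f + g) = Φ([γ], f) + Φ([γ], g)` when both orbital integrands are integrable at the representative (★ `orbitalIntegral_add`).
[cite: Rogawski1990, §4.1 (4.1.1) p. 39] -/
theorem classOrbitalIntegral_add (m : OrbitalMeasureFamily G) {f g : G → ℂ} (cl : ConjClasses G)
    (hf : Integrable (descConj (Quotient.out cl) (Subgroup.centralizer ({Quotient.out cl} : Set G))
      (fun _ hx => Subgroup.mem_centralizer_singleton_iff.1 hx) f) (m cl))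
    (hg : Integrable (descConj (Quotient.out cl) (Subgroup.centralizer ({Quotient.out cl} : Set G))
      (fun _ hx => Subgroup.mem_centralizer_singleton_iff.1 hx) g) (m cl)) :
    classOrbitalIntegral m (f + g) cl = classOrbitalIntegral m f cl + classOrbitalIntegral m g cl := by
  rw [classOrbitalIntegral_eq, classOrbitalIntegral_eq, classOrbitalIntegral_eq]
  exact orbitalIntegral_add _ _ hf hg

/-- `Φ([γ], f - g) = Φ([γ], f) - Φ([γ], g)` when both orbital integrands are integrable at the representative (★ `orbitalIntegral_sub`).
[cite: Rogawski1990, §4.1 (4.1.1) p. 39] -/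
theorem classOrbitalIntegral_sub (m : OrbitalMeasureFamily G) {f g : G → ℂ} (cl : ConjClasses G)
    (hf : Integrable (descConj (Quotient.out cl) (Subgroup.centralizer ({Quotient.out cl} : Set G))
      (fun _ hx => Subgroup.mem_centralizer_singleton_iff.1 hx) f) (m cl))
    (hg : Integrable (descConj (Quotient.out cl) (Subgroup.centralizer ({Quotient.out cl} : Set G))
      (fun _ hx => Subgroup.mem_centralizer_singleton_iff.1 hx) g) (m cl)) :
    classOrbitalIntegral m (f - g) cl = classOrbitalIntegral m f cl - classOrbitalIntegral m g cl := by
  rw [classOrbitalIntegral_eq, classOrbitalIntegral_eq, classOrbitalIntegral_eq]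
  exact orbitalIntegral_sub _ _ hf hg

/-- `Φ^st(γ, -f) = -Φ^st(γ, f)` — unconditionally (★ `stableOrbitalIntegralRel_smul_fun` at `a = -1`; homogeneity `Φ^st(γ, a • f) = a · Φ^st(γ, f)` IS ★
`stableOrbitalIntegralRel_smul_fun`, cited not restated). [cite: Rogawski1990, §4.1 (4.1.1) p. 39] -/
theorem stableOrbitalIntegralRel_neg (st : G → G → Prop) (m : OrbitalMeasureFamily G) (f : G → ℂ) (γ : G) :
    stableOrbitalIntegralRel st m (-f) γ = -stableOrbitalIntegralRel st m f γ := by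
  rw [← neg_one_smul ℂ f, stableOrbitalIntegralRel_smul_fun, neg_one_mul]

/-- **`Φ^st(γ, f + g) = Φ^st(γ, f) + Φ^st(γ, g)`** when (ii) finitely many classes `[γ′]` satisfy `st γ γ′` and (i) on each of them both orbital
integrands are integrable — both EXPLICIT (a corollary of ★ `stableOrbitalIntegralRel_add`, whose hypotheses are the finite non-zero supports +
class additivity, fed by ★ `orbitalIntegral_add`). [cite: Rogawski1990, §4.1 (4.1.1) p. 39] -/
theorem stableOrbitalIntegralRel_add_of_integrable {st : G → G → Prop} (m : OrbitalMeasureFamily G) {f g : G → ℂ} {γ : G}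
    (hfin : {cl : ConjClasses G | st γ (Quotient.out cl)}.Finite)
    (hf : ∀ cl : ConjClasses G, st γ (Quotient.out cl) →
      Integrable (descConj (Quotient.out cl) (Subgroup.centralizer ({Quotient.out cl} : Set G))
        (fun _ hx => Subgroup.mem_centralizer_singleton_iff.1 hx) f) (m cl))
    (hg : ∀ cl : ConjClasses G, st γ (Quotient.out cl) →
      Integrable (descConj (Quotient.out cl) (Subgroup.centralizer ({Quotient.out cl} : Set G))
        (fun _ hx => Subgroup.mem_centralizer_singleton_iff.1 hx) g) (m cl)) :
    stableOrbitalIntegralRel st m (f + g) γ = stableOrbitalIntegralRel st m f γ + stableOrbitalIntegralRel st m g γ :=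
  stableOrbitalIntegralRel_add st m (hfin.subset fun _ hc => hc.1) (hfin.subset fun _ hc => hc.1)
    fun cl hcl => classOrbitalIntegral_add m cl (hf cl hcl) (hg cl hcl)

/-- **`Φ^st(γ, f - g) = Φ^st(γ, f) - Φ^st(γ, g)`** under the same explicit finiteness and integrability binders. [cite: Rogawski1990, §4.1 (4.1.1) p. 39] -/
theorem stableOrbitalIntegralRel_sub_of_integrable {st : G → G → Prop} (m : OrbitalMeasureFamily G) {f g : G → ℂ} {γ : G}
    (hfin : {cl : ConjClasses G | st γ (Quotient.out cl)}.Finite)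
    (hf : ∀ cl : ConjClasses G, st γ (Quotient.out cl) →
      Integrable (descConj (Quotient.out cl) (Subgroup.centralizer ({Quotient.out cl} : Set G))
        (fun _ hx => Subgroup.mem_centralizer_singleton_iff.1 hx) f) (m cl))
    (hg : ∀ cl : ConjClasses G, st γ (Quotient.out cl) →
      Integrable (descConj (Quotient.out cl) (Subgroup.centralizer ({Quotient.out cl} : Set G))
        (fun _ hx => Subgroup.mem_centralizer_singleton_iff.1 hx) g) (m cl)) :
    stableOrbitalIntegralRel st m (f - g) γ = stableOrbitalIntegralRel st m f γ - stableOrbitalIntegralRel st m g γ := by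
  rw [stableOrbitalIntegralRel_def, stableOrbitalIntegralRel_def, stableOrbitalIntegralRel_def, ← finsum_mem_sub_distrib _ _ hfin]
  exact finsum_mem_congr rfl fun cl hcl => classOrbitalIntegral_sub m cl (hf cl hcl) (hg cl hcl)

end GSide

/-! ## §2 The ε-side: `Φ_ε(δ, ·)`, `Φ_ε(δ_c, ·)` and (4.10.1) `Φ^κ_ε(δ, ·)` are linear (generic `(G̃, ε)`, ★ `Ch4Sec10`) -/

section EpsSide

variable {Gt : Type*} [Group Gt] (ε : Gt →* Gt) {Z' : Subgroup Gt} [∀ δ : Gt, MeasurableSpace (Gt ⧸ epsCentralizer ε δ)]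
  {E : Type*} [NormedAddCommGroup E] [NormedSpace ℝ E]

/-- `Φ_ε(δ, c • φ) = c • Φ_ε(δ, φ)` — unconditionally (★ `integral_smul`; the twisted integrand of `c • φ` IS `c •` the twisted integrand, by `rfl`).
[cite: Rogawski1990, §1.6 pp. 5–6; §4.10 p. 57] -/
theorem epsOrbitalIntegral_smul {𝕜 : Type*} [NontriviallyNormedField 𝕜] [NormedSpace 𝕜 E] [SMulCommClass ℝ 𝕜 E]
    (δ : Gt) (m : Measure (Gt ⧸ epsCentralizer ε δ)) (c : 𝕜) (φ : Gt → E) :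
    epsOrbitalIntegral ε δ (c • φ) m = c • epsOrbitalIntegral ε δ φ m := by
  simp only [epsOrbitalIntegral]
  rw [← integral_smul]
  rfl

/-- `Φ_ε(δ, φ + ψ) = Φ_ε(δ, φ) + Φ_ε(δ, ψ)` when both twisted integrands `y ↦ φ(y δ ε(y)⁻¹)`, `y ↦ ψ(y δ ε(y)⁻¹)` (★ `descEpsConj`) are integrable.
[cite: Rogawski1990, §1.6 pp. 5–6; §4.10 p. 57] -/
theorem epsOrbitalIntegral_add (δ : Gt) (m : Measure (Gt ⧸ epsCentralizer ε δ)) {φ ψ : Gt → E}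
    (hφ : Integrable (descEpsConj ε δ (epsCentralizer ε δ) φ) m) (hψ : Integrable (descEpsConj ε δ (epsCentralizer ε δ) ψ) m) :
    epsOrbitalIntegral ε δ (φ + ψ) m = epsOrbitalIntegral ε δ φ m + epsOrbitalIntegral ε δ ψ m := by
  simp only [epsOrbitalIntegral]
  rw [← integral_add hφ hψ]
  rfl

/-- `Φ_ε(δ, -φ) = -Φ_ε(δ, φ)` — unconditionally. [cite: Rogawski1990, §1.6 pp. 5–6; §4.10 p. 57] -/
theorem epsOrbitalIntegral_neg (δ : Gt) (m : Measure (Gt ⧸ epsCentralizer ε δ)) (φ : Gt → E) :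
    epsOrbitalIntegral ε δ (-φ) m = -epsOrbitalIntegral ε δ φ m := by
  simp only [epsOrbitalIntegral]
  rw [← integral_neg]
  rfl

/-- `Φ_ε(δ, φ - ψ) = Φ_ε(δ, φ) - Φ_ε(δ, ψ)` when both twisted integrands are integrable. [cite: Rogawski1990, §1.6 pp. 5–6; §4.10 p. 57] -/
theorem epsOrbitalIntegral_sub (δ : Gt) (m : Measure (Gt ⧸ epsCentralizer ε δ)) {φ ψ : Gt → E}
    (hφ : Integrable (descEpsConj ε δ (epsCentralizer ε δ) φ) m) (hψ : Integrable (descEpsConj ε δ (epsCentralizer ε δ) ψ) m) :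
    epsOrbitalIntegral ε δ (φ - ψ) m = epsOrbitalIntegral ε δ φ m - epsOrbitalIntegral ε δ ψ m := by
  simp only [epsOrbitalIntegral]
  rw [← integral_sub hφ hψ]
  rfl

/-- `Φ_ε(δ_c, c • φ) = c · Φ_ε(δ_c, φ)` at every ε-class — unconditionally. [cite: Rogawski1990, §4.10 (4.10.1) p. 57] -/
theorem classEpsOrbitalIntegral_smul (m : EpsOrbitalMeasureFamily ε Z') (c : ℂ) (φ : Gt → ℂ) (cl : EpsConjClassesMod ε Z') :
    classEpsOrbitalIntegral ε m (c • φ) cl = c * classEpsOrbitalIntegral ε m φ cl := by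
  rw [classEpsOrbitalIntegral, classEpsOrbitalIntegral, epsOrbitalIntegral_smul, smul_eq_mul]

/-- `Φ_ε(δ_c, φ + ψ) = Φ_ε(δ_c, φ) + Φ_ε(δ_c, ψ)` when both twisted integrands are integrable at the representative `δ_c = out c`.
[cite: Rogawski1990, §4.10 (4.10.1) p. 57] -/
theorem classEpsOrbitalIntegral_add (m : EpsOrbitalMeasureFamily ε Z') {φ ψ : Gt → ℂ} (cl : EpsConjClassesMod ε Z')
    (hφ : Integrable (descEpsConj ε (Quotient.out cl) (epsCentralizer ε (Quotient.out cl)) φ) (m cl))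
    (hψ : Integrable (descEpsConj ε (Quotient.out cl) (epsCentralizer ε (Quotient.out cl)) ψ) (m cl)) :
    classEpsOrbitalIntegral ε m (φ + ψ) cl = classEpsOrbitalIntegral ε m φ cl + classEpsOrbitalIntegral ε m ψ cl := by
  rw [classEpsOrbitalIntegral, classEpsOrbitalIntegral, classEpsOrbitalIntegral]
  exact epsOrbitalIntegral_add ε _ _ hφ hψ

/-- `Φ_ε(δ_c, φ - ψ) = Φ_ε(δ_c, φ) - Φ_ε(δ_c, ψ)` when both twisted integrands are integrable at the representative. [cite: Rogawski1990, §4.10 (4.10.1) p. 57] -/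
theorem classEpsOrbitalIntegral_sub (m : EpsOrbitalMeasureFamily ε Z') {φ ψ : Gt → ℂ} (cl : EpsConjClassesMod ε Z')
    (hφ : Integrable (descEpsConj ε (Quotient.out cl) (epsCentralizer ε (Quotient.out cl)) φ) (m cl))
    (hψ : Integrable (descEpsConj ε (Quotient.out cl) (epsCentralizer ε (Quotient.out cl)) ψ) (m cl)) :
    classEpsOrbitalIntegral ε m (φ - ψ) cl = classEpsOrbitalIntegral ε m φ cl - classEpsOrbitalIntegral ε m ψ cl := by
  rw [classEpsOrbitalIntegral, classEpsOrbitalIntegral, classEpsOrbitalIntegral]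
  exact epsOrbitalIntegral_sub ε _ _ hφ hψ

/-- **(4.10.1) is homogeneous: `Φ^κ_ε(δ, c • φ) = c · Φ^κ_ε(δ, φ)` — UNCONDITIONALLY** (any `stε`, `κ`, `e`; `c * Σᶠ = Σᶠ c * ·` in `ℂ`).
[cite: Rogawski1990, §4.10 (4.10.1) p. 57] -/
theorem epsKappaOrbitalIntegral_smul (stε : Gt → Gt → Prop) (κ : Gt → EpsConjClassesMod ε Z' → ℂ) (e : Gt → ℂ)
    (m : EpsOrbitalMeasureFamily ε Z') (c : ℂ) (φ : Gt → ℂ) (δ : Gt) :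
    epsKappaOrbitalIntegral ε stε κ e m (c • φ) δ = c * epsKappaOrbitalIntegral ε stε κ e m φ δ := by
  unfold epsKappaOrbitalIntegral
  rw [mul_finsum_mem]
  exact finsum_mem_congr rfl fun cl _ => by rw [classEpsOrbitalIntegral_smul]; ring

/-- `Φ^κ_ε(δ, -φ) = -Φ^κ_ε(δ, φ)` — unconditionally. [cite: Rogawski1990, §4.10 (4.10.1) p. 57] -/
theorem epsKappaOrbitalIntegral_neg (stε : Gt → Gt → Prop) (κ : Gt → EpsConjClassesMod ε Z' → ℂ) (e : Gt → ℂ)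
    (m : EpsOrbitalMeasureFamily ε Z') (φ : Gt → ℂ) (δ : Gt) :
    epsKappaOrbitalIntegral ε stε κ e m (-φ) δ = -epsKappaOrbitalIntegral ε stε κ e m φ δ := by
  rw [← neg_one_smul ℂ φ, epsKappaOrbitalIntegral_smul, neg_one_mul]

/-- **(4.10.1) is additive: `Φ^κ_ε(δ, φ + ψ) = Φ^κ_ε(δ, φ) + Φ^κ_ε(δ, ψ)`** when (ii) finitely many ε-classes `c` satisfy `stε δ (out c)`
(«`𝒟_ε(δ∕F)` finite») and (i) on each of them both twisted integrands are integrable — both EXPLICIT. [cite: Rogawski1990, §4.10 (4.10.1) p. 57] -/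
theorem epsKappaOrbitalIntegral_add (stε : Gt → Gt → Prop) (κ : Gt → EpsConjClassesMod ε Z' → ℂ) (e : Gt → ℂ)
    (m : EpsOrbitalMeasureFamily ε Z') {φ ψ : Gt → ℂ} {δ : Gt}
    (hfin : {c : EpsConjClassesMod ε Z' | stε δ (Quotient.out c)}.Finite)
    (hφ : ∀ c : EpsConjClassesMod ε Z', stε δ (Quotient.out c) →
      Integrable (descEpsConj ε (Quotient.out c) (epsCentralizer ε (Quotient.out c)) φ) (m c))
    (hψ : ∀ c : EpsConjClassesMod ε Z', stε δ (Quotient.out c) →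
      Integrable (descEpsConj ε (Quotient.out c) (epsCentralizer ε (Quotient.out c)) ψ) (m c)) :
    epsKappaOrbitalIntegral ε stε κ e m (φ + ψ) δ = epsKappaOrbitalIntegral ε stε κ e m φ δ + epsKappaOrbitalIntegral ε stε κ e m ψ δ := by
  unfold epsKappaOrbitalIntegral
  rw [← finsum_mem_add_distrib hfin]
  exact finsum_mem_congr rfl fun cl hcl => by rw [classEpsOrbitalIntegral_add ε m cl (hφ cl hcl) (hψ cl hcl)]; ring

/-- **`Φ^κ_ε(δ, φ - ψ) = Φ^κ_ε(δ, φ) - Φ^κ_ε(δ, ψ)`** under the same explicit finiteness and integrability binders. [cite: Rogawski1990, §4.10 (4.10.1) p. 57] -/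
theorem epsKappaOrbitalIntegral_sub (stε : Gt → Gt → Prop) (κ : Gt → EpsConjClassesMod ε Z' → ℂ) (e : Gt → ℂ)
    (m : EpsOrbitalMeasureFamily ε Z') {φ ψ : Gt → ℂ} {δ : Gt}
    (hfin : {c : EpsConjClassesMod ε Z' | stε δ (Quotient.out c)}.Finite)
    (hφ : ∀ c : EpsConjClassesMod ε Z', stε δ (Quotient.out c) →
      Integrable (descEpsConj ε (Quotient.out c) (epsCentralizer ε (Quotient.out c)) φ) (m c))
    (hψ : ∀ c : EpsConjClassesMod ε Z', stε δ (Quotient.out c) →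
      Integrable (descEpsConj ε (Quotient.out c) (epsCentralizer ε (Quotient.out c)) ψ) (m c)) :
    epsKappaOrbitalIntegral ε stε κ e m (φ - ψ) δ = epsKappaOrbitalIntegral ε stε κ e m φ δ - epsKappaOrbitalIntegral ε stε κ e m ψ δ := by
  unfold epsKappaOrbitalIntegral
  rw [← finsum_mem_sub_distrib _ _ hfin]
  exact finsum_mem_congr rfl fun cl hcl => by rw [classEpsOrbitalIntegral_sub ε m cl (hφ cl hcl) (hψ cl hcl)]; ring

end EpsSide

/-! ## §3 The S4 instance: `Φ^st_ε` on `G̃_v = GL₃(∏_{w∣v} L_w)` with `ε_v = epsLoc L Φ v`, and the relation «`φ → f`» (4.10.2)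

Convention S4-R7 (C-TT ED. 2): the orbit spaces `G̃_v ⧸ G̃_{δε}` and `G_v ⧸ G_γ` carry their σ-algebras as GENERIC INSTANCE BINDERS (installed as
`borel _` at socket level), never synthesised from a group-level `MeasurableSpace`. -/

section S4

variable {L : Type} [Field L] [NumberField L] [IsCMField L] {Φ : GL (Fin 3) L}
  {v : HeightOneSpectrum (𝓞 ↥(maximalRealSubfield L))}
  [∀ δ : GtLoc L v, MeasurableSpace (GtLoc L v ⧸ epsCentralizer (epsLoc L Φ v) δ)]

/-- `Φ^st_ε(δ, c • φ) = c · Φ^st_ε(δ, φ)` — unconditionally. [cite: Rogawski1990, §4.10 (4.10.1) p. 57] -/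
theorem stableEpsOrbitalIntegral_smul (mGt : EpsOrbitalMeasureFamily (epsLoc L Φ v) ⊥) (c : ℂ) (φ : GtLoc L v → ℂ) (δ : GtLoc L v) :
    stableEpsOrbitalIntegral L Φ v mGt (c • φ) δ = c * stableEpsOrbitalIntegral L Φ v mGt φ δ :=
  epsKappaOrbitalIntegral_smul (epsLoc L Φ v) _ _ _ mGt c φ δ

/-- `Φ^st_ε(δ, -φ) = -Φ^st_ε(δ, φ)` — unconditionally. [cite: Rogawski1990, §4.10 (4.10.1) p. 57] -/
theorem stableEpsOrbitalIntegral_neg (mGt : EpsOrbitalMeasureFamily (epsLoc L Φ v) ⊥) (φ : GtLoc L v → ℂ) (δ : GtLoc L v) :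
    stableEpsOrbitalIntegral L Φ v mGt (-φ) δ = -stableEpsOrbitalIntegral L Φ v mGt φ δ :=
  epsKappaOrbitalIntegral_neg (epsLoc L Φ v) _ _ _ mGt φ δ

/-- `Φ^st_ε(δ, φ + ψ) = Φ^st_ε(δ, φ) + Φ^st_ε(δ, ψ)` under EXPLICIT (ii) finiteness of the stable ε-class of `δ` modulo ε-conjugacy and (i)
integrability of both twisted integrands on each contributing class. [cite: Rogawski1990, §4.10 (4.10.1) p. 57] -/
theorem stableEpsOrbitalIntegral_add (mGt : EpsOrbitalMeasureFamily (epsLoc L Φ v) ⊥) {φ ψ : GtLoc L v → ℂ} {δ : GtLoc L v}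
    (hfin : {c : EpsConjClassesMod (epsLoc L Φ v) ⊥ | IsStablyEpsConjAt L Φ v δ (Quotient.out c)}.Finite)
    (hφ : ∀ c : EpsConjClassesMod (epsLoc L Φ v) ⊥, IsStablyEpsConjAt L Φ v δ (Quotient.out c) →
      Integrable (descEpsConj (epsLoc L Φ v) (Quotient.out c) (epsCentralizer (epsLoc L Φ v) (Quotient.out c)) φ) (mGt c))
    (hψ : ∀ c : EpsConjClassesMod (epsLoc L Φ v) ⊥, IsStablyEpsConjAt L Φ v δ (Quotient.out c) →
      Integrable (descEpsConj (epsLoc L Φ v) (Quotient.out c) (epsCentralizer (epsLoc L Φ v) (Quotient.out c)) ψ) (mGt c)) :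
    stableEpsOrbitalIntegral L Φ v mGt (φ + ψ) δ = stableEpsOrbitalIntegral L Φ v mGt φ δ + stableEpsOrbitalIntegral L Φ v mGt ψ δ :=
  epsKappaOrbitalIntegral_add (epsLoc L Φ v) _ _ _ mGt hfin hφ hψ

/-- `Φ^st_ε(δ, φ - ψ) = Φ^st_ε(δ, φ) - Φ^st_ε(δ, ψ)` under the same explicit binders. [cite: Rogawski1990, §4.10 (4.10.1) p. 57] -/
theorem stableEpsOrbitalIntegral_sub (mGt : EpsOrbitalMeasureFamily (epsLoc L Φ v) ⊥) {φ ψ : GtLoc L v → ℂ} {δ : GtLoc L v}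
    (hfin : {c : EpsConjClassesMod (epsLoc L Φ v) ⊥ | IsStablyEpsConjAt L Φ v δ (Quotient.out c)}.Finite)
    (hφ : ∀ c : EpsConjClassesMod (epsLoc L Φ v) ⊥, IsStablyEpsConjAt L Φ v δ (Quotient.out c) →
      Integrable (descEpsConj (epsLoc L Φ v) (Quotient.out c) (epsCentralizer (epsLoc L Φ v) (Quotient.out c)) φ) (mGt c))
    (hψ : ∀ c : EpsConjClassesMod (epsLoc L Φ v) ⊥, IsStablyEpsConjAt L Φ v δ (Quotient.out c) →
      Integrable (descEpsConj (epsLoc L Φ v) (Quotient.out c) (epsCentralizer (epsLoc L Φ v) (Quotient.out c)) ψ) (mGt c)) :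
    stableEpsOrbitalIntegral L Φ v mGt (φ - ψ) δ = stableEpsOrbitalIntegral L Φ v mGt φ δ - stableEpsOrbitalIntegral L Φ v mGt ψ δ :=
  epsKappaOrbitalIntegral_sub (epsLoc L Φ v) _ _ _ mGt hfin hφ hψ

variable [∀ γ : (UnitaryGroup.cmDatum L 3 (Φ : Matrix (Fin 3) (Fin 3) L)).Local v,
  MeasurableSpace ((UnitaryGroup.cmDatum L 3 (Φ : Matrix (Fin 3) (Fin 3) L)).Local v ⧸
    Subgroup.centralizer ({γ} : Set ((UnitaryGroup.cmDatum L 3 (Φ : Matrix (Fin 3) (Fin 3) L)).Local v)))]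

/-- **«`φ → f`» is homogeneous: `φ → f` ⟹ `c • φ → c • f` — UNCONDITIONALLY.** [cite: Rogawski1990, §4.10 (4.10.2) p. 58] -/
theorem IsEpsTransferPair.smul {mGt : EpsOrbitalMeasureFamily (epsLoc L Φ v) ⊥}
    {mG : OrbitalMeasureFamily ((UnitaryGroup.cmDatum L 3 (Φ : Matrix (Fin 3) (Fin 3) L)).Local v)}
    {φ : GtLoc L v → ℂ} {f : (UnitaryGroup.cmDatum L 3 (Φ : Matrix (Fin 3) (Fin 3) L)).Local v → ℂ}
    (h : IsEpsTransferPair L Φ v mGt mG φ f) (c : ℂ) :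
    IsEpsTransferPair L Φ v mGt mG (c • φ) (c • f) := by
  intro δ hδ γ hγ
  rw [stableEpsOrbitalIntegral_smul, stableOrbitalIntegralRel_smul_fun, h δ hδ γ hγ]

/-- **«`φ → f`» ⟹ «`-φ → -f`» — unconditionally.** [cite: Rogawski1990, §4.10 (4.10.2) p. 58] -/
theorem IsEpsTransferPair.neg {mGt : EpsOrbitalMeasureFamily (epsLoc L Φ v) ⊥}
    {mG : OrbitalMeasureFamily ((UnitaryGroup.cmDatum L 3 (Φ : Matrix (Fin 3) (Fin 3) L)).Local v)}
    {φ : GtLoc L v → ℂ} {f : (UnitaryGroup.cmDatum L 3 (Φ : Matrix (Fin 3) (Fin 3) L)).Local v → ℂ}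
    (h : IsEpsTransferPair L Φ v mGt mG φ f) :
    IsEpsTransferPair L Φ v mGt mG (-φ) (-f) := by
  intro δ hδ γ hγ
  rw [stableEpsOrbitalIntegral_neg, stableOrbitalIntegralRel_neg, h δ hδ γ hγ]

/-- **«`φ → f`» is additive: `φ → f` and `ψ → g` ⟹ `φ + ψ → f + g`**, UNDER EXPLICIT BINDERS — on the ε-side, at every ε-regular `δ`: (ii) the
stable ε-class of `δ` meets finitely many ε-classes and (i) both twisted integrands are integrable on each; on the `G`-side, at every norm
`γ ∈ 𝒩(δ)` of an ε-regular `δ`: (ii) finitely many conjugacy classes in the stable class of `γ` and (i) both orbital integrands integrable on each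
(Bochner ∕ `finsum` junk otherwise; the tree claims neither finiteness today). [cite: Rogawski1990, §4.10 (4.10.2) p. 58; §4.1 (4.1.1) p. 39] -/
theorem IsEpsTransferPair.add {mGt : EpsOrbitalMeasureFamily (epsLoc L Φ v) ⊥}
    {mG : OrbitalMeasureFamily ((UnitaryGroup.cmDatum L 3 (Φ : Matrix (Fin 3) (Fin 3) L)).Local v)}
    {φ ψ : GtLoc L v → ℂ} {f g : (UnitaryGroup.cmDatum L 3 (Φ : Matrix (Fin 3) (Fin 3) L)).Local v → ℂ}
    (h₁ : IsEpsTransferPair L Φ v mGt mG φ f) (h₂ : IsEpsTransferPair L Φ v mGt mG ψ g)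
    (hGtfin : ∀ δ : GtLoc L v, IsEpsRegularAt L Φ v δ →
      {c : EpsConjClassesMod (epsLoc L Φ v) ⊥ | IsStablyEpsConjAt L Φ v δ (Quotient.out c)}.Finite)
    (hφ : ∀ δ : GtLoc L v, IsEpsRegularAt L Φ v δ → ∀ c : EpsConjClassesMod (epsLoc L Φ v) ⊥, IsStablyEpsConjAt L Φ v δ (Quotient.out c) →
      Integrable (descEpsConj (epsLoc L Φ v) (Quotient.out c) (epsCentralizer (epsLoc L Φ v) (Quotient.out c)) φ) (mGt c))
    (hψ : ∀ δ : GtLoc L v, IsEpsRegularAt L Φ v δ → ∀ c : EpsConjClassesMod (epsLoc L Φ v) ⊥, IsStablyEpsConjAt L Φ v δ (Quotient.out c) →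
      Integrable (descEpsConj (epsLoc L Φ v) (Quotient.out c) (epsCentralizer (epsLoc L Φ v) (Quotient.out c)) ψ) (mGt c))
    (hGfin : ∀ δ : GtLoc L v, IsEpsRegularAt L Φ v δ → ∀ γ : (UnitaryGroup.cmDatum L 3 (Φ : Matrix (Fin 3) (Fin 3) L)).Local v,
      IsEpsNormPair L Φ v δ γ →
        {cl : ConjClasses ((UnitaryGroup.cmDatum L 3 (Φ : Matrix (Fin 3) (Fin 3) L)).Local v) | IsStablyConjGAt L Φ v γ (Quotient.out cl)}.Finite)
    (hf : ∀ δ : GtLoc L v, IsEpsRegularAt L Φ v δ → ∀ γ : (UnitaryGroup.cmDatum L 3 (Φ : Matrix (Fin 3) (Fin 3) L)).Local v,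
      IsEpsNormPair L Φ v δ γ → ∀ cl : ConjClasses ((UnitaryGroup.cmDatum L 3 (Φ : Matrix (Fin 3) (Fin 3) L)).Local v),
        IsStablyConjGAt L Φ v γ (Quotient.out cl) →
          Integrable (descConj (Quotient.out cl) (Subgroup.centralizer ({Quotient.out cl} : Set _))
            (fun _ hx => Subgroup.mem_centralizer_singleton_iff.1 hx) f) (mG cl))
    (hg : ∀ δ : GtLoc L v, IsEpsRegularAt L Φ v δ → ∀ γ : (UnitaryGroup.cmDatum L 3 (Φ : Matrix (Fin 3) (Fin 3) L)).Local v,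
      IsEpsNormPair L Φ v δ γ → ∀ cl : ConjClasses ((UnitaryGroup.cmDatum L 3 (Φ : Matrix (Fin 3) (Fin 3) L)).Local v),
        IsStablyConjGAt L Φ v γ (Quotient.out cl) →
          Integrable (descConj (Quotient.out cl) (Subgroup.centralizer ({Quotient.out cl} : Set _))
            (fun _ hx => Subgroup.mem_centralizer_singleton_iff.1 hx) g) (mG cl)) :
    IsEpsTransferPair L Φ v mGt mG (φ + ψ) (f + g) := by
  intro δ hδ γ hγ
  rw [stableEpsOrbitalIntegral_add mGt (hGtfin δ hδ) (hφ δ hδ) (hψ δ hδ),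
    stableOrbitalIntegralRel_add_of_integrable mG (hGfin δ hδ γ hγ) (hf δ hδ γ hγ) (hg δ hδ γ hγ), h₁ δ hδ γ hγ, h₂ δ hδ γ hγ]

/-- **«`φ → f`» and «`ψ → g`» ⟹ «`φ - ψ → f - g`»**, under the same explicit binders as `IsEpsTransferPair.add`.
[cite: Rogawski1990, §4.10 (4.10.2) p. 58; §4.1 (4.1.1) p. 39] -/
theorem IsEpsTransferPair.sub {mGt : EpsOrbitalMeasureFamily (epsLoc L Φ v) ⊥}
    {mG : OrbitalMeasureFamily ((UnitaryGroup.cmDatum L 3 (Φ : Matrix (Fin 3) (Fin 3) L)).Local v)}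
    {φ ψ : GtLoc L v → ℂ} {f g : (UnitaryGroup.cmDatum L 3 (Φ : Matrix (Fin 3) (Fin 3) L)).Local v → ℂ}
    (h₁ : IsEpsTransferPair L Φ v mGt mG φ f) (h₂ : IsEpsTransferPair L Φ v mGt mG ψ g)
    (hGtfin : ∀ δ : GtLoc L v, IsEpsRegularAt L Φ v δ →
      {c : EpsConjClassesMod (epsLoc L Φ v) ⊥ | IsStablyEpsConjAt L Φ v δ (Quotient.out c)}.Finite)
    (hφ : ∀ δ : GtLoc L v, IsEpsRegularAt L Φ v δ → ∀ c : EpsConjClassesMod (epsLoc L Φ v) ⊥, IsStablyEpsConjAt L Φ v δ (Quotient.out c) →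
      Integrable (descEpsConj (epsLoc L Φ v) (Quotient.out c) (epsCentralizer (epsLoc L Φ v) (Quotient.out c)) φ) (mGt c))
    (hψ : ∀ δ : GtLoc L v, IsEpsRegularAt L Φ v δ → ∀ c : EpsConjClassesMod (epsLoc L Φ v) ⊥, IsStablyEpsConjAt L Φ v δ (Quotient.out c) →
      Integrable (descEpsConj (epsLoc L Φ v) (Quotient.out c) (epsCentralizer (epsLoc L Φ v) (Quotient.out c)) ψ) (mGt c))
    (hGfin : ∀ δ : GtLoc L v, IsEpsRegularAt L Φ v δ → ∀ γ : (UnitaryGroup.cmDatum L 3 (Φ : Matrix (Fin 3) (Fin 3) L)).Local v,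
      IsEpsNormPair L Φ v δ γ →
        {cl : ConjClasses ((UnitaryGroup.cmDatum L 3 (Φ : Matrix (Fin 3) (Fin 3) L)).Local v) | IsStablyConjGAt L Φ v γ (Quotient.out cl)}.Finite)
    (hf : ∀ δ : GtLoc L v, IsEpsRegularAt L Φ v δ → ∀ γ : (UnitaryGroup.cmDatum L 3 (Φ : Matrix (Fin 3) (Fin 3) L)).Local v,
      IsEpsNormPair L Φ v δ γ → ∀ cl : ConjClasses ((UnitaryGroup.cmDatum L 3 (Φ : Matrix (Fin 3) (Fin 3) L)).Local v),
        IsStablyConjGAt L Φ v γ (Quotient.out cl) →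
          Integrable (descConj (Quotient.out cl) (Subgroup.centralizer ({Quotient.out cl} : Set _))
            (fun _ hx => Subgroup.mem_centralizer_singleton_iff.1 hx) f) (mG cl))
    (hg : ∀ δ : GtLoc L v, IsEpsRegularAt L Φ v δ → ∀ γ : (UnitaryGroup.cmDatum L 3 (Φ : Matrix (Fin 3) (Fin 3) L)).Local v,
      IsEpsNormPair L Φ v δ γ → ∀ cl : ConjClasses ((UnitaryGroup.cmDatum L 3 (Φ : Matrix (Fin 3) (Fin 3) L)).Local v),
        IsStablyConjGAt L Φ v γ (Quotient.out cl) →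
          Integrable (descConj (Quotient.out cl) (Subgroup.centralizer ({Quotient.out cl} : Set _))
            (fun _ hx => Subgroup.mem_centralizer_singleton_iff.1 hx) g) (mG cl)) :
    IsEpsTransferPair L Φ v mGt mG (φ - ψ) (f - g) := by
  intro δ hδ γ hγ
  rw [stableEpsOrbitalIntegral_sub mGt (hGtfin δ hδ) (hφ δ hδ) (hψ δ hδ),
    stableOrbitalIntegralRel_sub_of_integrable mG (hGfin δ hδ γ hγ) (hf δ hδ γ hγ) (hg δ hδ γ hγ), h₁ δ hδ γ hγ, h₂ δ hδ γ hγ]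

end S4

end Summit.HodgeConjecture.HodgeConjecture.R90.S4

end
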